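import Literature.NumberTheory.GaloisRepresentations.IdeleClassCarryInvariant
import Literature.NumberTheory.GaloisRepresentations.IdeleLocalPairDecomposition
import Literature.NumberTheory.GaloisRepresentations.LocalUnramifiedFundamentalClassInvariant
import Literature.NumberTheory.GaloisRepresentations.AdmissibleModulus
import Literature.NumberTheory.GaloisRepresentations.HeckeCharacterProofs
import Literature.NumberTheory.GaloisCohomology.CorrectionAtPArithmetic
import Literature.Algebra.Homology.FiniteCyclicCarryClassFunctoriality
import HarnessLib

/-!
# The local invariant of the idèle carry class `[c_σ · ⟨ϖ_v⟩]` at a place with full decomposition group and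
# Frobenius `σ` is `−1/n` (Tate, C–F VII §11.3, the local computation; Serre, *Local Fields* XIII §4)

Topic `NumberTheory/GaloisRepresentations`; namespace `Literature.NumberTheory.GaloisRepresentations.IdeleCohomology`
(sequel to `IdeleClassCarryInvariant`: `carryInv σ x = classInv [c_σ · ι[x]]`, `carryInvChar`).  Theorems only (no
definition, no named fact, no instance, no notation, no `sorry`); number fields in `Type`.

Let `E/F` be a CYCLIC extension of number fields with group `G = ⟨σ⟩` of order `n`, `v` a finite place of `F`
UNRAMIFIED in `E` with a place `w ∣ v` of FULL decomposition group `G_w = G` whose Frobenius is `σ` (Chebotarev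
supplies such places: tree `exists_place_stabilizer_eq_zpowers`), `ϖ = ϖ_v ∈ F_vˣ` the tree's uniformiser
(`HeckeCharacter.uniformizer`) and `x = ⟨ϖ⟩_v ∈ 𝕀_F` the idèle `ϖ` at `v`, `1` elsewhere (`localUnits v ϖ`).  Then

* §1 the base change `x_E ∈ J_E` is `G`-invariant, with trivial blocks away from `v` and at infinity and block
  `ϖ` (diagonally) at `v`;
* §2 `carryInv σ x = inv_E [c_σ · x_E] = localInvAt w [c_σ · x_E]` (naturality of the carry class along
  `J_E → C_E`, door-c6 g12 `classInv_ideleToClass`, door-c5 `inv = Σ_v inv_v`: all other local invariants vanish);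
* §3 through Shapiro (`Sh_w = H²(G_w ↪ G, π_w)` then `G_w ≃ Gal(E_w/F_v)`) the component at `v` is the carry class
  `[c_{σ_w} · ϖ]` of the completed layer `E_w/F_v` for the generator `σ_w` corresponding to `σ`
  (engine `FiniteCyclic.map_carryClassHom_of_apply_eq`);
* §4 **`localInvAt_carryClass_localUnits_uniformizer`**: its invariant is `−(1 % n)/n ∈ ℚ/ℤ` — `layerInv` is the
  Brauer invariant of the inflated class, the engine's carry class inflates to the tree's cyclic class
  (`unitsInfTwo_H2π_frobeniusCocycle`), whose character kills the inertia of `F_v` and takes the value `ι_σ(σ) = 1`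
  at an arithmetic Frobenius (`IdeleLocalPairDecomposition`), so the tree's unramified formula
  `brauerInvariantEquiv_cyclicClass_of_unramified` (`inv(θ, x) = −v(x)·θ(φ)/n`) gives `−1/n`;
  **`carryInv_localUnits_uniformizer`**: `carryInv σ ⟨ϖ_v⟩_v = −(1 % n)/n`.

HONEST FRAMING: classical (Tate 1967 §11.3 reduces "the norm residue map of the class formation is the Artin map"
to exactly this local computation at one unramified place); written for Route A of crux `AnticycControlAdditiveK`
(cell bsd-schneider); proves no case of BSD.

## References
* J. W. S. Cassels, A. Fröhlich (eds.), *Algebraic Number Theory* (1967), Ch. VII (J. Tate) §11.3, §7.2–7.3.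
  [CasselsFrohlichANT1967]
* J.-P. Serre, *Local Fields*, GTM 67 (1979), Ch. XIII §3–§4 (invariants of unramified classes). [SerreLocalFields1979]
* J. Neukirch, *Class Field Theory — The Bonn Lectures* (2013), Part II §4 (proof of (4.5)). [Neukirch2013]
-/

noncomputable section

open NumberField IsDedekindDomain CategoryTheory groupCohomology Function Field
open Literature.NumberTheory.Automorphic

namespace Literature.NumberTheory.GaloisRepresentations

namespace IdeleCohomology

open SemiLocal Literature.Algebra.Homology DiscreteGaloisModule IsNonarchimedeanLocalField IdeleClassGroup
open Literature.AnabelianGeometry.AbsoluteAnabelian.Prop121vii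
open Literature.NumberTheory.GaloisCohomology (ord_adicCompletion_eq_of_valued_eq brauerInvariantEquiv_cyclicClass_of_unramified)

variable {F : Type} [Field F] [NumberField F] {E : Type} [Field E] [NumberField E] [Algebra F E] [IsGalois F E]

/-! ## §1. The idèle `x_E` of a local idèle `⟨u⟩_v` of the base: invariance and blocks -/

section Blocks

variable (v : HeightOneSpectrum (𝓞 F)) (u : (v.adicCompletion F)ˣ)

omit [IsGalois F E] in
/-- **The base change of an idèle of `F` is a `Gal(E/F)`-invariant vector of `J_E`.**
[cite: CasselsFrohlichANT1967, Ch. VII §8 Prop. 8.1] -/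
theorem ofMul_ideleBaseChange_mem_invariants (x : ideleGroup F) :
    Additive.ofMul (AdeleRing.ideleBaseChange F E x) ∈ (ideleRep F E).ρ.invariants := fun g => by
  rw [ideleRep_ρ_apply, toMul_ofMul, AdeleRing.smul_ideleBaseChange]

omit [IsGalois F E] in
/-- **`J_E → C_E` takes `x_E` to `ι[x]`**: the class of the base change is the base change of the class.
[cite: CasselsFrohlichANT1967, Ch. VII §8] -/
theorem classRepHom_hom_ofMul_ideleBaseChange (x : ideleGroup F) :
    (classRepHom F E).hom (Additive.ofMul (AdeleRing.ideleBaseChange F E x)) =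
      Additive.ofMul (classBaseChange F E (x : IdeleClassGroup F)) := rfl

omit [IsGalois F E] in
/-- **The block of `(⟨u⟩_v)_E` at a finite place `v' ≠ v` is trivial.** [cite: CasselsFrohlichANT1967, Ch. VII §7.2] -/
theorem blockHom_ideleBaseChange_localUnits_of_ne {v' : HeightOneSpectrum (𝓞 F)} (hv' : v' ≠ v) :
    IdeleHerbrand.blockHom F E v' (AdeleRing.ideleBaseChange F E (localUnits v u)) = 1 := by
  refine Units.ext ?_
  rw [IdeleHerbrand.val_blockHom_ideleBaseChange, localUnits_snd_apply_of_ne u hv', map_one, Units.val_one]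

omit [IsGalois F E] in
/-- **The block of `(⟨u⟩_v)_E` at `v` is `u`, diagonally**: its component at every `w ∣ v` is `u ∈ F_v ⊆ E_w`.
[cite: CasselsFrohlichANT1967, Ch. VII §7.2] -/
theorem unitsProj_blockHom_ideleBaseChange_localUnits (w : Place F E v) :
    Additive.toMul (unitsProj w (Additive.ofMul (IdeleHerbrand.blockHom F E v (AdeleRing.ideleBaseChange F E (localUnits v u))))) =
      Units.map (algebraMap (v.adicCompletion F) ((w : HeightOneSpectrum (𝓞 E)).adicCompletion E) : _ →* _) u := by
  refine Units.ext ?_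
  rw [val_toMul_unitsProj, toMul_ofMul, IdeleHerbrand.val_blockHom_ideleBaseChange, localUnits_snd_apply_self, SemiLocal.algebraMap_apply]
  rfl

omit [IsGalois F E] in
/-- **The archimedean part of `(⟨u⟩_v)_E` is trivial.** [cite: CasselsFrohlichANT1967, Ch. VII §7.2] -/
theorem infHom_ideleBaseChange_localUnits :
    IdeleHerbrand.infHom E (AdeleRing.ideleBaseChange F E (localUnits v u)) = 1 := by
  refine Units.ext ?_
  change ((AdeleRing.ideleBaseChange F E (localUnits v u) : ideleGroup E) : AdeleRing (𝓞 E) E).1 = 1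
  rw [AdeleRing.coe_ideleBaseChange, AdeleRing.baseChange_fst, localUnits_fst, map_one]

end Blocks

/-! ## §2. `carryInv σ ⟨u⟩_v = inv_E [c_σ · (⟨u⟩_v)_E] = localInvAt w [c_σ · (⟨u⟩_v)_E]` -/

section Global

variable (σ : E ≃ₐ[F] E) (hσ : ∀ g, g ∈ Subgroup.zpowers σ)

omit [IsGalois F E] in
/-- **`[c_σ · ι[x]] = H²(J_E → C_E) [c_σ · x_E]`** (naturality of the carry class along `J_E → C_E`).
[cite: SerreLocalFields1979, Ch. VIII §4 (Remark)][cite: CasselsFrohlichANT1967, Ch. VII §11.2] -/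
theorem carryClassHom_baseInvariant_eq_ideleToClass (x : ideleGroup F) :
    FiniteCyclic.carryClassHom σ hσ (galoisRep F E) (baseInvariant x) =
      ideleToClass F E (FiniteCyclic.carryClassHom σ hσ (ideleRep F E) (⟨Additive.ofMul (AdeleRing.ideleBaseChange F E x), ofMul_ideleBaseChange_mem_invariants x⟩ : (ideleRep F E).ρ.invariants)) := by
  rw [ideleToClass_apply, FiniteCyclic.map_id_carryClassHom]
  rfl

/-- **`carryInv σ x = inv_E [c_σ · x_E]`** (door-c6 g12's `classInv ∘ H²(J_E → C_E) = inv`).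
[cite: CasselsFrohlichANT1967, Ch. VII §11.2] -/
theorem carryInv_eq_inv [IsCyclic (E ≃ₐ[F] E)] (x : ideleGroup F) :
    carryInv (E := E) σ hσ x = inv E (FiniteCyclic.carryClassHom σ hσ (ideleRep F E) (⟨Additive.ofMul (AdeleRing.ideleBaseChange F E x), ofMul_ideleBaseChange_mem_invariants x⟩ : (ideleRep F E).ρ.invariants)) := by
  rw [carryInv_apply, carryClassHom_baseInvariant_eq_ideleToClass, classInv_ideleToClass]

omit [IsGalois F E] in
/-- **The component at `v'` of `[c_σ · x_E]` is the carry class of the block of `x_E` at `v'`.**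
[cite: SerreLocalFields1979, Ch. VIII §4 (Remark)][cite: CasselsFrohlichANT1967, Ch. VII §7.3] -/
theorem map_placeProj_carryClassHom_ideleBaseChange (x : ideleGroup F) (v' : HeightOneSpectrum (𝓞 F)) :
    groupCohomology.map (MonoidHom.id (E ≃ₐ[F] E)) (placeProj v') 2
        (FiniteCyclic.carryClassHom σ hσ (ideleRep F E) (⟨Additive.ofMul (AdeleRing.ideleBaseChange F E x), ofMul_ideleBaseChange_mem_invariants x⟩ : (ideleRep F E).ρ.invariants)) =
      FiniteCyclic.carryClassHom σ hσ (unitsRep F E v')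
        ⟨Additive.ofMul (IdeleHerbrand.blockHom F E v' (AdeleRing.ideleBaseChange F E x)),
          FiniteCyclic.coe_mem_invariants_map (placeProj v') (⟨Additive.ofMul (AdeleRing.ideleBaseChange F E x), ofMul_ideleBaseChange_mem_invariants x⟩ : (ideleRep F E).ρ.invariants)⟩ :=
  FiniteCyclic.map_id_carryClassHom σ hσ (placeProj v') (⟨Additive.ofMul (AdeleRing.ideleBaseChange F E x), ofMul_ideleBaseChange_mem_invariants x⟩ : (ideleRep F E).ρ.invariants)

variable (v : HeightOneSpectrum (𝓞 F)) (u : (v.adicCompletion F)ˣ)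

/-- **The local invariants of `[c_σ · (⟨u⟩_v)_E]` away from `v` vanish** (the block there is trivial).
[cite: CasselsFrohlichANT1967, Ch. VII §7.3 Cor. 7.4 (b)] -/
theorem localInvAt_carryClass_localUnits_eq_zero_of_ne {v' : HeightOneSpectrum (𝓞 F)} (hv' : v' ≠ v) (w' : Place F E v') :
    localInvAt w' (FiniteCyclic.carryClassHom σ hσ (ideleRep F E) (⟨Additive.ofMul (AdeleRing.ideleBaseChange F E (localUnits v u)), ofMul_ideleBaseChange_mem_invariants (localUnits v u)⟩ : (ideleRep F E).ρ.invariants)) = 0 := by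
  rw [localInvAt_eq_zero_iff, map_placeProj_carryClassHom_ideleBaseChange]
  have h0 : (⟨Additive.ofMul (IdeleHerbrand.blockHom F E v' (AdeleRing.ideleBaseChange F E (localUnits v u))),
      FiniteCyclic.coe_mem_invariants_map (placeProj v') (⟨Additive.ofMul (AdeleRing.ideleBaseChange F E (localUnits v u)), ofMul_ideleBaseChange_mem_invariants (localUnits v u)⟩ : (ideleRep F E).ρ.invariants)⟩ :
        (unitsRep F E v').ρ.invariants) = 0 :=
    Subtype.ext (by
      change Additive.ofMul (IdeleHerbrand.blockHom F E v' (AdeleRing.ideleBaseChange F E (localUnits v u))) = 0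
      rw [blockHom_ideleBaseChange_localUnits_of_ne v u hv']
      rfl)
  rw [h0, map_zero]

/-- **The archimedean invariants of `[c_σ · (⟨u⟩_v)_E]` vanish** (the archimedean part is trivial).
[cite: CasselsFrohlichANT1967, Ch. VII §7.3 Cor. 7.4 (b)] -/
theorem localInvInfAt_carryClass_localUnits_eq_zero (w₀ : InfinitePlace E) :
    localInvInfAt (F := F) w₀ (FiniteCyclic.carryClassHom σ hσ (ideleRep F E) (⟨Additive.ofMul (AdeleRing.ideleBaseChange F E (localUnits v u)), ofMul_ideleBaseChange_mem_invariants (localUnits v u)⟩ : (ideleRep F E).ρ.invariants)) = 0 := by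
  rw [localInvInfAt_eq_zero_iff, FiniteCyclic.map_id_carryClassHom]
  have h0 : (⟨(infPlaceProj (E := E) (w₀.comap (algebraMap F E))).hom
      ((⟨Additive.ofMul (AdeleRing.ideleBaseChange F E (localUnits v u)), ofMul_ideleBaseChange_mem_invariants (localUnits v u)⟩ : (ideleRep F E).ρ.invariants) : (ideleRep F E).V),
      FiniteCyclic.coe_mem_invariants_map (infPlaceProj (E := E) (w₀.comap (algebraMap F E)))
        (⟨Additive.ofMul (AdeleRing.ideleBaseChange F E (localUnits v u)), ofMul_ideleBaseChange_mem_invariants (localUnits v u)⟩ : (ideleRep F E).ρ.invariants)⟩ : (ArchHerbrand.archUnitsRep (E := E) (w₀.comap (algebraMap F E))).ρ.invariants) = 0 :=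
    Subtype.ext (by
      change Additive.ofMul ((ArchHerbrand.cutoff E (w₀.comap (algebraMap F E)))
        (IdeleHerbrand.infHom E (AdeleRing.ideleBaseChange F E (localUnits v u)))) = 0
      rw [infHom_ideleBaseChange_localUnits, map_one]
      rfl)
  rw [h0, map_zero]

/-- **`carryInv σ ⟨u⟩_v = inv_v [c_σ · (⟨u⟩_v)_E]`, read at any place `w ∣ v`**: all other local invariants vanish
and the invariant at `v` does not depend on the place above `v` (door-c5 `localInv_eq_localInvAt`).
[cite: CasselsFrohlichANT1967, Ch. VII §11.2–11.3] -/
theorem carryInv_localUnits_eq_localInvAt [IsCyclic (E ≃ₐ[F] E)] (w : Place F E v) :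
    carryInv (E := E) σ hσ (localUnits v u) =
      localInvAt w (FiniteCyclic.carryClassHom σ hσ (ideleRep F E) (⟨Additive.ofMul (AdeleRing.ideleBaseChange F E (localUnits v u)), ofMul_ideleBaseChange_mem_invariants (localUnits v u)⟩ : (ideleRep F E).ρ.invariants)) := by
  classical
  rw [carryInv_eq_inv, inv_eq_sum _ {v} (fun v' hv' => ?_)]
  · rw [Finset.sum_singleton, localInv_eq_localInvAt w, Finset.sum_eq_zero (fun vi _ => ?_), add_zero]
    exact localInvInfAt_carryClass_localUnits_eq_zero σ hσ v u _
  · rw [localInv_eq_localInvAt (chosenPlace (E := E) v')]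
    exact localInvAt_carryClass_localUnits_eq_zero_of_ne σ hσ v u (fun h => hv' (Finset.mem_singleton.2 h)) _

end Global

/-! ## §3–§4. The invariant at a place of full decomposition group with Frobenius `σ` -/

section Local

variable {v : HeightOneSpectrum (𝓞 F)}

/-- **The local computation** (Tate VII §11.3; Serre XIII §4).  Let `E/F` be cyclic with generator `σ`, `v` a finite
place unramified in `E`, `w ∣ v` with full decomposition group `G_w = Gal(E/F)` and `galFrob F E v = σ`.  Then the
local invariant at `w` of the carry class `[c_σ · (⟨ϖ_v⟩_v)_E] ∈ H²(Gal(E/F), J_E)` of the uniformiser idèle is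
`−(1 % n)/n ∈ ℚ/ℤ`, `n = #Gal(E/F)` (`= −1/n` for `n > 1`): through Shapiro it is the carry class of the
unramified completed layer `E_w/F_v` for the arithmetic Frobenius on the uniformiser `ϖ_v`, whose Brauer invariant
in the tree's normalisation is `−v(ϖ_v)·ι(Frob)/n` (`brauerInvariantEquiv_cyclicClass_of_unramified`).
[cite: CasselsFrohlichANT1967, Ch. VII §11.3][cite: SerreLocalFields1979, Ch. XIII §4] -/
theorem localInvAt_carryClass_localUnits_uniformizer (σ : E ≃ₐ[F] E)
    (hσ : ∀ g, g ∈ Subgroup.zpowers σ) (hcomm : ∀ a b : E ≃ₐ[F] E, Commute a b)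
    (w : Place F E v) (hunr : Algebra.IsUnramifiedIn (𝓞 E) v.asIdeal)
    (hstab : MulAction.stabilizer (E ≃ₐ[F] E) w = ⊤) (hfrob : galFrob F E v = σ) :
    localInvAt w (FiniteCyclic.carryClassHom σ hσ (ideleRep F E)
        (⟨Additive.ofMul (AdeleRing.ideleBaseChange F E (localUnits v (HeckeCharacter.uniformizer F v))), ofMul_ideleBaseChange_mem_invariants (localUnits v (HeckeCharacter.uniformizer F v))⟩ : (ideleRep F E).ρ.invariants)) =
      -((((1 % Nat.card (E ≃ₐ[F] E) : ℕ) : ℚ) / (Nat.card (E ≃ₐ[F] E) : ℕ) : ℚ) : AddCircle (1 : ℚ)) := by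
  classical
  haveI := finiteDimensional_place (K := F) w
  haveI := isGalois_place (F := F) w
  haveI : CharZero (v.adicCompletion F) := charZero_adicCompletion v
  -- §3a the generator `σ_S` of the (full) decomposition group
  let σS : MulAction.stabilizer (E ≃ₐ[F] E) w := ⟨σ, by rw [hstab]; exact Subgroup.mem_top σ⟩
  have hσS : ∀ g : MulAction.stabilizer (E ≃ₐ[F] E) w, g ∈ Subgroup.zpowers σS := fun g => by
    obtain ⟨k, hk⟩ := Subgroup.mem_zpowers_iff.1 (hσ (g : E ≃ₐ[F] E))
    exact Subgroup.mem_zpowers_iff.2 ⟨k, Subtype.ext (by rw [Subgroup.coe_zpow]; exact hk)⟩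
  have hcardS : Fintype.card (MulAction.stabilizer (E ≃ₐ[F] E) w) = Fintype.card (E ≃ₐ[F] E) := by
    rw [Fintype.card_eq_nat_card, Fintype.card_eq_nat_card, hstab, Subgroup.card_top]
  -- §3b the corresponding generator `σ_w` of `Gal(E_w/F_v)` and its transport `σ''` to `Gal(E₀/F_v)`,
  -- `E₀ = embeddedField F_v E_w ⊆ F̄_v`
  have hσl : ∀ g : ((w : HeightOneSpectrum (𝓞 E)).adicCompletion E) ≃ₐ[v.adicCompletion F]
      ((w : HeightOneSpectrum (𝓞 E)).adicCompletion E), g ∈ Subgroup.zpowers (decompMulEquiv w σS) := fun g => by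
    obtain ⟨k, hk⟩ := Subgroup.mem_zpowers_iff.1 (hσS ((decompMulEquiv w).symm g))
    exact Subgroup.mem_zpowers_iff.2 ⟨k, by rw [← map_zpow, hk, MulEquiv.apply_symm_apply]⟩
  have hel : ((decompMulEquiv w).symm : _ →* MulAction.stabilizer (E ≃ₐ[F] E) w) (decompMulEquiv w σS) = σS :=
    (decompMulEquiv w).symm_apply_apply σS
  have hcardl : Fintype.card (((w : HeightOneSpectrum (𝓞 E)).adicCompletion E) ≃ₐ[v.adicCompletion F]
      ((w : HeightOneSpectrum (𝓞 E)).adicCompletion E)) = Fintype.card (MulAction.stabilizer (E ≃ₐ[F] E) w) :=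
    Fintype.card_congr (decompMulEquiv w).toEquiv.symm
  have hσ'' : ∀ g : (embeddedField (v.adicCompletion F) ((w : HeightOneSpectrum (𝓞 E)).adicCompletion E)) ≃ₐ[v.adicCompletion F]
      (embeddedField (v.adicCompletion F) ((w : HeightOneSpectrum (𝓞 E)).adicCompletion E)),
      g ∈ Subgroup.zpowers ((embeddedEquiv (v.adicCompletion F) ((w : HeightOneSpectrum (𝓞 E)).adicCompletion E)).autCongr
        (decompMulEquiv w σS)) := fun g => by
    obtain ⟨k, hk⟩ := Subgroup.mem_zpowers_iff.1 (hσl ((embeddedEquiv (v.adicCompletion F)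
      ((w : HeightOneSpectrum (𝓞 E)).adicCompletion E)).autCongr.symm g))
    exact Subgroup.mem_zpowers_iff.2 ⟨k, by rw [← map_zpow, hk, MulEquiv.apply_symm_apply]⟩
  have he'' : ((embeddedEquiv (v.adicCompletion F) ((w : HeightOneSpectrum (𝓞 E)).adicCompletion E)).autCongr.symm : _ →* _)
      ((embeddedEquiv (v.adicCompletion F) ((w : HeightOneSpectrum (𝓞 E)).adicCompletion E)).autCongr (decompMulEquiv w σS)) =
        decompMulEquiv w σS :=
    (embeddedEquiv (v.adicCompletion F) ((w : HeightOneSpectrum (𝓞 E)).adicCompletion E)).autCongr.symm_apply_apply _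
  have hcard'' : Fintype.card ((embeddedField (v.adicCompletion F) ((w : HeightOneSpectrum (𝓞 E)).adicCompletion E)) ≃ₐ[v.adicCompletion F]
      (embeddedField (v.adicCompletion F) ((w : HeightOneSpectrum (𝓞 E)).adicCompletion E))) =
      Fintype.card (((w : HeightOneSpectrum (𝓞 E)).adicCompletion E) ≃ₐ[v.adicCompletion F]
        ((w : HeightOneSpectrum (𝓞 E)).adicCompletion E)) :=
    Fintype.card_congr (embeddedEquiv (v.adicCompletion F) ((w : HeightOneSpectrum (𝓞 E)).adicCompletion E)).autCongr.toEquiv.symm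
  -- §3c the exponent chain: `ι_{σ''}(s|_{E₀}) = ι_σ((localPair w).f s)` for `s ∈ Γ_{F_v}`
  have hexp : ∀ s : absoluteGaloisGroup (v.adicCompletion F),
      Unramified.exponent _ hσ'' (resGal (embeddedField (v.adicCompletion F) ((w : HeightOneSpectrum (𝓞 E)).adicCompletion E)) s) =
        Unramified.exponent σ hσ ((localPair w).f s) := fun s => by
    rw [← FiniteCyclic.exponent_comp_eq _ hσl _ hσ'' _ he'' hcard'' (resGal _ s),
      ← FiniteCyclic.exponent_comp_eq σS hσS _ hσl _ hel hcardl,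
      ← FiniteCyclic.exponent_comp_eq σ hσ σS hσS (MulAction.stabilizer (E ≃ₐ[F] E) w).subtype rfl hcardS]
    rfl
  -- §3d the component at `v`, through Shapiro, is the carry class `[c_{σ_w} · ϖ]` of the completed layer
  have hϖA : ∀ g : ((w : HeightOneSpectrum (𝓞 E)).adicCompletion E) ≃ₐ[v.adicCompletion F] ((w : HeightOneSpectrum (𝓞 E)).adicCompletion E),
      (Rep.ofAlgebraAutOnUnits (v.adicCompletion F) ((w : HeightOneSpectrum (𝓞 E)).adicCompletion E)).ρ g
        (Additive.ofMul (Units.map (algebraMap (v.adicCompletion F) ((w : HeightOneSpectrum (𝓞 E)).adicCompletion E) : _ →* _)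
          (HeckeCharacter.uniformizer F v))) =
      Additive.ofMul (Units.map (algebraMap (v.adicCompletion F) ((w : HeightOneSpectrum (𝓞 E)).adicCompletion E) : _ →* _)
          (HeckeCharacter.uniformizer F v)) := fun g => by
    rw [ofAlgebraAutOnUnits_ρ_ofMul]
    exact congrArg Additive.ofMul (Units.ext (g.commutes (HeckeCharacter.uniformizer F v : v.adicCompletion F)))
  have hSh : (groupCohomologyUnitsRepIsoAut w 2).hom (groupCohomology.map (MonoidHom.id (E ≃ₐ[F] E)) (placeProj v) 2
      (FiniteCyclic.carryClassHom σ hσ (ideleRep F E) (⟨Additive.ofMul (AdeleRing.ideleBaseChange F E (localUnits v (HeckeCharacter.uniformizer F v))), ofMul_ideleBaseChange_mem_invariants (localUnits v (HeckeCharacter.uniformizer F v))⟩ : (ideleRep F E).ρ.invariants))) =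
      FiniteCyclic.carryClassHom (decompMulEquiv w σS) hσl
        (Rep.ofAlgebraAutOnUnits (v.adicCompletion F) ((w : HeightOneSpectrum (𝓞 E)).adicCompletion E)) ⟨_, hϖA⟩ := by
    rw [map_placeProj_carryClassHom_ideleBaseChange]
    change (groupCohomologyLocalUnitsRepIso w 2).hom ((groupCohomologyUnitsRepIso w 2).hom _) = _
    rw [groupCohomologyUnitsRepIso_hom_eq,
      FiniteCyclic.map_carryClassHom_of_apply_eq σ hσ σS hσS (MulAction.stabilizer (E ≃ₐ[F] E) w).subtype rfl hcardS,
      groupCohomologyLocalUnitsRepIso, groupCohomology.mapIso_hom,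
      FiniteCyclic.map_carryClassHom_of_apply_eq σS hσS _ hσl _ hel hcardl]
    congr 1
    refine Subtype.ext ?_
    exact congrArg Additive.ofMul (unitsProj_blockHom_ideleBaseChange_localUnits v (HeckeCharacter.uniformizer F v) w)
  -- §4a `layerInv` of the carry class = Brauer invariant of the tree's cyclic class `(θ_{σ''}, ϖ)`
  have hϖ0 : ((HeckeCharacter.uniformizer F v : v.adicCompletion F)) ≠ 0 := (HeckeCharacter.uniformizer F v).ne_zero
  have hlayer : UnitsLayer.layerInv (v.adicCompletion F) ((w : HeightOneSpectrum (𝓞 E)).adicCompletion E)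
      (FiniteCyclic.carryClassHom (decompMulEquiv w σS) hσl
        (Rep.ofAlgebraAutOnUnits (v.adicCompletion F) ((w : HeightOneSpectrum (𝓞 E)).adicCompletion E)) ⟨_, hϖA⟩) =
      brauerInvariantEquiv (v.adicCompletion F) (cyclicClass (layerCyclicCharacter (v.adicCompletion F) _ _ hσ'')
        (units (v.adicCompletion F)) (baseUnitsInvariant (v.adicCompletion F) _ hϖ0)) := by
    rw [FiniteCyclic.carryClassHom_apply, layerInv_eq_brauerInvariantEquiv_unitsAbsInfTwo, unitsAbsInfTwo_apply,
      unitsCohomologyIso_embeddedEquiv_hom,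
      FiniteCyclic.map_H2π_frobeniusCocycle_of_apply_eq _ hσl _ hσ'' _ he'' hcard''
        (absUnitsResHom (v.adicCompletion F) ((w : HeightOneSpectrum (𝓞 E)).adicCompletion E)),
      unitsInfTwo_H2π_frobeniusCocycle]
    congr 2
    refine Subtype.ext (congrArg UnitsCarrier.ofUnits (Units.ext ?_))
    change (((embeddedEquiv (v.adicCompletion F) ((w : HeightOneSpectrum (𝓞 E)).adicCompletion E))
        (algebraMap (v.adicCompletion F) ((w : HeightOneSpectrum (𝓞 E)).adicCompletion E)
          (HeckeCharacter.uniformizer F v : v.adicCompletion F)) :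
        embeddedField (v.adicCompletion F) ((w : HeightOneSpectrum (𝓞 E)).adicCompletion E)) :
        AlgebraicClosure (v.adicCompletion F)) =
      algebraMap (v.adicCompletion F) (AlgebraicClosure (v.adicCompletion F)) (HeckeCharacter.uniformizer F v : v.adicCompletion F)
    rw [coe_embeddedEquiv, AlgHom.commutes]
  -- §4b the character `θ_{σ''}` kills the inertia of `F_v` and takes the value `ι_σ(σ) = 1 % n` at Frobenius
  obtain ⟨φ, hφ⟩ := exists_isAbsArithFrob_holds (v.adicCompletion F)
  have hI : ∀ τ ∈ absInertia (v.adicCompletion F), layerCyclicCharacter (v.adicCompletion F) _ _ hσ'' τ = 0 := fun τ hτ => by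
    rw [layerCyclicCharacter_apply, hexp, localPair_f_eq_one_of_mem_absInertia hcomm w hunr hτ, Unramified.exponent_one,
      Nat.cast_zero]
  have hval : (layerCyclicCharacter (v.adicCompletion F) _ _ hσ'' φ).val = 1 % Fintype.card (E ≃ₐ[F] E) := by
    rw [val_layerCyclicCharacter, hexp, localPair_f_eq_galFrob hcomm w hunr hφ, hfrob, Unramified.exponent_self]
  have hord : LocalWeilDatum.ord (v.adicCompletion F) (HeckeCharacter.uniformizer F v : v.adicCompletion F) = 1 :=
    ord_adicCompletion_eq_of_valued_eq v hϖ0 (e := 1) (HeckeCharacter.valued_uniformizer v)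
  -- §4c assemble
  rw [localInvAt_apply, hSh, hlayer,
    brauerInvariantEquiv_cyclicClass_of_unramified (v.adicCompletion F) (layerCyclicCharacter (v.adicCompletion F) _ _ hσ'') hI
      (IsAbsArithFrob.isFrobPow_holds hφ) (HeckeCharacter.uniformizer F v : v.adicCompletion F) hϖ0,
    hord, hval, hcard'', hcardl, hcardS, Fintype.card_eq_nat_card, one_mul, Int.cast_natCast]

/-- **`carryInv σ ⟨ϖ_v⟩_v = −(1 % n)/n`** at a place `v` unramified in `E` with a place `w ∣ v` of full decomposition
group and `galFrob F E v = σ`. [cite: CasselsFrohlichANT1967, Ch. VII §11.3][cite: SerreLocalFields1979, Ch. XIII §4] -/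
theorem carryInv_localUnits_uniformizer [IsCyclic (E ≃ₐ[F] E)] (σ : E ≃ₐ[F] E) (hσ : ∀ g, g ∈ Subgroup.zpowers σ) (hcomm : ∀ a b : E ≃ₐ[F] E, Commute a b)
    (w : Place F E v) (hunr : Algebra.IsUnramifiedIn (𝓞 E) v.asIdeal)
    (hstab : MulAction.stabilizer (E ≃ₐ[F] E) w = ⊤) (hfrob : galFrob F E v = σ) :
    carryInv (E := E) σ hσ (localUnits v (HeckeCharacter.uniformizer F v)) =
      -((((1 % Nat.card (E ≃ₐ[F] E) : ℕ) : ℚ) / (Nat.card (E ≃ₐ[F] E) : ℕ) : ℚ) : AddCircle (1 : ℚ)) := by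
  rw [carryInv_localUnits_eq_localInvAt σ hσ v _ w,
    localInvAt_carryClass_localUnits_uniformizer σ hσ hcomm w hunr hstab hfrob]

end Local

end IdeleCohomology

end Literature.NumberTheory.GaloisRepresentations

end
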